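import Literature.Analysis.FluidPDE.FourierL2PicardCauchy
import HarnessLib

/-!
# The limit of the Picard scheme: a Fourier-side mild solution in the rough class

Fifteenth file of the weighted-`L²` Fourier-side construction of the local smooth solution of
the Navier–Stokes system with `H¹`-controlled lifespan (discharge of
`Literature.Analysis.FluidPDE.tao2011_fourier_local_existence`; Tao 2013, Thm. 5.4 (ii)+(iv)).

Under Tao's smallness condition the Picard iterates `v_n = picardIter c T a n` converge at every
`(t, ξ)` (geometrically, with every polynomial weight: `FourierL2PicardCauchy`) to the tree's
pointwise limit `v = picardLimit c T a`. This file establishes the properties of the limit used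
by the physical-space synthesis:

* `v = h - E` with `h(t) = heat(clamp t) • a` and `E` **jointly continuous with pointwise
  polynomial decay of every order, uniformly in time** (`continuous_hsub_picardLimit`,
  `exists_hasDecay_hsub_picardLimit`);
* the **mild (Duhamel) equation** `v = duhamel c T a v` (`picardLimit_eq_duhamel`), the initial
  value `v(0) = a` (`picardLimit_zero`), the divergence-free condition (`sum_mul_picardLimit`) and
  the conjugation symmetry (`picardLimit_conj_symm`), the last two by induction along the
  iteration in the `L²` class (`sum_mul_duhamel_of_tendsto`, `duhamel_conj_symm_of_tendsto`).

## References

* T. Tao, Anal. PDE 6 (2013) = arXiv:1108.1165, Thm. 5.4 (ii) (arXiv Thm. 31) and the proof of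
  Thm. 5.1 (arXiv Thm. 28, p. 16: contraction mapping in `X¹`). [Tao2011]
* J. Leray, Acta Math. 63 (1934), §19 (successive approximations).
-/

noncomputable section

open MeasureTheory Real Set Filter Function intervalIntegral
open scoped ENNReal NNReal ComplexConjugate
open _root_.Topology

namespace Literature.Analysis.FluidPDE.FourierNS

/-! ### Divergence-free and conjugation symmetry of the Duhamel map in the `L²` class -/

section DuhamelL2

variable {ι : Type*} [Fintype ι] [DecidableEq ι] {c T : ℝ} {a : EuclideanSpace ℝ ι → ι → ℂ}
  {v : ℝ → EuclideanSpace ℝ ι → ι → ℂ}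

/-- **`Φ(v)` is divergence free** (Fourier side) for an `L²`-continuous trajectory `v` with
square-integrable components and a divergence-free datum: `∑ₗ ξₗ Φ(v)(t,ξ)ₗ = 0`
(`sum_mul_nonlin`; the tree's `sum_mul_duhamel` in the `L²` class). [folklore] -/
theorem sum_mul_duhamel_of_tendsto (hv : ∀ s j, MemLp (v s · j) 2 volume)
    (hvc : ∀ j s₀, Tendsto (fun s => eLpNorm ((v s · j) - (v s₀ · j)) 2 volume) (𝓝 s₀) (𝓝 0))
    (hdiv : ∀ ξ, ∑ l, (ξ l : ℂ) * a ξ l = 0) (t : ℝ) (ξ : EuclideanSpace ℝ ι) :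
    ∑ l, (ξ l : ℂ) * duhamel c T a v t ξ l = 0 := by
  simp only [duhamel_eq, Pi.sub_apply, Pi.smul_apply, Complex.real_smul, mul_sub,
    Finset.sum_sub_distrib]
  have h1 : ∑ l, (ξ l : ℂ) * ((heat c ξ (clamp T t) : ℂ) * a ξ l) = 0 := by
    calc ∑ l, (ξ l : ℂ) * ((heat c ξ (clamp T t) : ℂ) * a ξ l)
        = (heat c ξ (clamp T t) : ℂ) * ∑ l, (ξ l : ℂ) * a ξ l := by
          rw [Finset.mul_sum]; congr 1 with l; ring
      _ = 0 := by rw [hdiv, mul_zero]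
  have hii : ∀ l, IntervalIntegrable (fun s => (ξ l : ℂ) * (heat c ξ (clamp T t - s) *
      nonlin (v s) (v s) ξ l)) volume 0 (clamp T t) := fun l => by
    have := ((continuous_apply l).comp (continuous_duhamel_integrand_time_of_tendsto (c := c) hv hvc
      (clamp T t) ξ)).const_smul (ξ l : ℂ)
    refine (this.intervalIntegrable _ _).congr fun s _ => ?_
    simp [Complex.real_smul]
  have hz : ∀ s, ∑ l, (ξ l : ℂ) * ((heat c ξ (clamp T t - s) : ℂ) * nonlin (v s) (v s) ξ l) = 0 :=
    fun s => by
    calc ∑ l, (ξ l : ℂ) * ((heat c ξ (clamp T t - s) : ℂ) * nonlin (v s) (v s) ξ l)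
        = (heat c ξ (clamp T t - s) : ℂ) * ∑ l, (ξ l : ℂ) * nonlin (v s) (v s) ξ l := by
          rw [Finset.mul_sum]; congr 1 with l; ring
      _ = 0 := by rw [sum_mul_nonlin, mul_zero]
  have h2 : ∑ l, (ξ l : ℂ) * duhamelIntegral c T v t ξ l = 0 := by
    simp_rw [duhamelIntegral_apply_of_tendsto hv hvc, ← intervalIntegral.integral_const_mul]
    rw [← intervalIntegral.integral_finsetSum fun l _ => hii l]
    have : (fun s => ∑ l, (ξ l : ℂ) * ((heat c ξ (clamp T t - s) : ℂ) * nonlin (v s) (v s) ξ l)) =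
        fun _ => (0 : ℂ) := funext hz
    rw [this, intervalIntegral.integral_zero]
  rw [h1, h2, sub_zero]

/-- **Conjugation symmetry of `Φ(v)`** in the `L²` class: if `a(-ξ) = conj a(ξ)` and
`v(s,-ξ) = conj v(s,ξ)` componentwise, then `Φ(v)(t,-ξ) = conj Φ(v)(t,ξ)` (the heat factor is
real and even; `nonlin_conj_symm`). [folklore] -/
theorem duhamel_conj_symm_of_tendsto (hv : ∀ s j, MemLp (v s · j) 2 volume)
    (hvc : ∀ j s₀, Tendsto (fun s => eLpNorm ((v s · j) - (v s₀ · j)) 2 volume) (𝓝 s₀) (𝓝 0))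
    (ha : ∀ ξ l, a (-ξ) l = conj (a ξ l)) (hvs : ∀ s ξ l, v s (-ξ) l = conj (v s ξ l)) (t : ℝ)
    (ξ : EuclideanSpace ℝ ι) (l : ι) :
    duhamel c T a v t (-ξ) l = conj (duhamel c T a v t ξ l) := by
  simp only [duhamel_eq, Pi.sub_apply, Pi.smul_apply, Complex.real_smul, map_sub, map_mul,
    Complex.conj_ofReal, heat_neg, ha]
  congr 1
  rw [duhamelIntegral_apply_of_tendsto hv hvc, duhamelIntegral_apply_of_tendsto hv hvc,
    ← intervalIntegral.intervalIntegral_conj]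
  congr 1 with s
  rw [map_mul, Complex.conj_ofReal, heat_neg, nonlin_conj_symm (hvs s) (hvs s)]

end DuhamelL2

/-! ### The limit and its class -/

section Limit

variable {c T : ℝ} {a : EuclideanSpace ℝ (Fin 3) → Fin 3 → ℂ}

/-- The pointwise Cauchy property of the Picard iterates under the smallness condition.
[cite: Tao2011, proof of Thm. 5.1 (arXiv Thm. 28, p. 16)] -/
theorem cauchySeq_picardIter (hc : 0 < c) (hT : 0 ≤ T) (ha : AEStronglyMeasurable a volume)
    (haw : ∀ (k : ℕ) j, ∫⁻ η, (ENNReal.ofReal ((1 + ‖η‖) ^ k) * ‖a η j‖ₑ) ^ 2 < ⊤)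
    (hs : 2304 * (ENNReal.ofReal (4 * π) * (Fintype.card (Fin 3) : ℝ≥0∞) ^ 2) ^ 2 *
        ((SNormLESNormFDerivOfEqConst ℂ (volume : Measure (EuclideanSpace ℝ (Fin 3))) 2 *
          ENNReal.ofReal (2 * π)) ^ (3 / 2 : ℝ)) ^ 2 * ENNReal.ofReal c⁻¹ *
        (ENNReal.ofReal T * ENNReal.ofReal (2 / c)) ^ (1 / 2 : ℝ) *
        (∫⁻ η, (ENNReal.ofReal ‖η‖ * ∑ j, ‖a η j‖ₑ) ^ 2) ≤ 1) (t : ℝ) (ξ : EuclideanSpace ℝ (Fin 3)) :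
    CauchySeq fun n => picardIter c T a n t ξ := by
  obtain ⟨B, hB⟩ := exists_geometric_norm_bound_diff_picardIter hc hT ha haw hs 0
  refine cauchySeq_of_le_geometric (1 / 2) B (by norm_num) fun n => ?_
  rw [dist_eq_norm, ← norm_neg, neg_sub]
  simpa using hB n t ξ

/-- The iterates converge to `picardLimit`. [folklore] -/
theorem tendsto_picardIter_picardLimit (hc : 0 < c) (hT : 0 ≤ T) (ha : AEStronglyMeasurable a volume)
    (haw : ∀ (k : ℕ) j, ∫⁻ η, (ENNReal.ofReal ((1 + ‖η‖) ^ k) * ‖a η j‖ₑ) ^ 2 < ⊤)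
    (hs : 2304 * (ENNReal.ofReal (4 * π) * (Fintype.card (Fin 3) : ℝ≥0∞) ^ 2) ^ 2 *
        ((SNormLESNormFDerivOfEqConst ℂ (volume : Measure (EuclideanSpace ℝ (Fin 3))) 2 *
          ENNReal.ofReal (2 * π)) ^ (3 / 2 : ℝ)) ^ 2 * ENNReal.ofReal c⁻¹ *
        (ENNReal.ofReal T * ENNReal.ofReal (2 / c)) ^ (1 / 2 : ℝ) *
        (∫⁻ η, (ENNReal.ofReal ‖η‖ * ∑ j, ‖a η j‖ₑ) ^ 2) ≤ 1) (t : ℝ) (ξ : EuclideanSpace ℝ (Fin 3)) :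
    Tendsto (fun n => picardIter c T a n t ξ) atTop (𝓝 (picardLimit c T a t ξ)) :=
  (cauchySeq_picardIter hc hT ha haw hs t ξ).tendsto_limUnder

/-- **Weighted rate of convergence**: for every `K` there is `B` with
`(1+‖ξ‖)^K ‖picardIter n t ξ - picardLimit t ξ‖ ≤ B (1/2)^n` for all `n, t, ξ`.
[cite: Tao2011, proof of Thm. 5.1 (arXiv Thm. 28, p. 16)] -/
theorem exists_norm_picardIter_sub_picardLimit_le (hc : 0 < c) (hT : 0 ≤ T)
    (ha : AEStronglyMeasurable a volume)
    (haw : ∀ (k : ℕ) j, ∫⁻ η, (ENNReal.ofReal ((1 + ‖η‖) ^ k) * ‖a η j‖ₑ) ^ 2 < ⊤)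
    (hs : 2304 * (ENNReal.ofReal (4 * π) * (Fintype.card (Fin 3) : ℝ≥0∞) ^ 2) ^ 2 *
        ((SNormLESNormFDerivOfEqConst ℂ (volume : Measure (EuclideanSpace ℝ (Fin 3))) 2 *
          ENNReal.ofReal (2 * π)) ^ (3 / 2 : ℝ)) ^ 2 * ENNReal.ofReal c⁻¹ *
        (ENNReal.ofReal T * ENNReal.ofReal (2 / c)) ^ (1 / 2 : ℝ) *
        (∫⁻ η, (ENNReal.ofReal ‖η‖ * ∑ j, ‖a η j‖ₑ) ^ 2) ≤ 1) (K : ℕ) :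
    ∃ B : ℝ, ∀ n t ξ, (1 + ‖ξ‖) ^ K * ‖picardIter c T a n t ξ - picardLimit c T a t ξ‖ ≤
      B * (1 / 2) ^ n := by
  obtain ⟨B, hB⟩ := exists_geometric_norm_bound_diff_picardIter hc hT ha haw hs K
  refine ⟨2 * B, fun n t ξ => ?_⟩
  have hw : (0 : ℝ) < (1 + ‖ξ‖) ^ K := by positivity
  have hdist : ∀ m, dist (picardIter c T a m t ξ) (picardIter c T a (m + 1) t ξ) ≤
      B * ((1 + ‖ξ‖) ^ K)⁻¹ * (1 / 2) ^ m := fun m => by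
    rw [dist_eq_norm, ← norm_neg, neg_sub, mul_assoc, mul_comm ((1 + ‖ξ‖) ^ K)⁻¹, ← mul_assoc,
      ← div_eq_mul_inv, le_div_iff₀ hw, mul_comm]
    exact hB m t ξ
  have h := dist_le_of_le_geometric_of_tendsto (1 / 2) (B * ((1 + ‖ξ‖) ^ K)⁻¹) (by norm_num) hdist
    (tendsto_picardIter_picardLimit hc hT ha haw hs t ξ) n
  rw [dist_eq_norm] at h
  calc (1 + ‖ξ‖) ^ K * ‖picardIter c T a n t ξ - picardLimit c T a t ξ‖
      ≤ (1 + ‖ξ‖) ^ K * (B * ((1 + ‖ξ‖) ^ K)⁻¹ * (1 / 2) ^ n / (1 - 1 / 2)) :=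
        mul_le_mul_of_nonneg_left h hw.le
    _ = 2 * B * (1 / 2) ^ n := by field_simp; ring

/-- The limit only sees the clamped time. [folklore] -/
theorem picardLimit_clamp (hT : 0 ≤ T) (t : ℝ) : picardLimit c T a (clamp T t) = picardLimit c T a t := by
  funext ξ
  simp only [picardLimit, picardIter_clamp hT]

/-- **Joint continuity of the Duhamel part of the limit** `E = h - picardLimit` (uniform limit of
the jointly continuous `E_n`). [folklore] -/
theorem continuous_hsub_picardLimit (hc : 0 < c) (hT : 0 ≤ T) (ha : AEStronglyMeasurable a volume)
    (haw : ∀ (k : ℕ) j, ∫⁻ η, (ENNReal.ofReal ((1 + ‖η‖) ^ k) * ‖a η j‖ₑ) ^ 2 < ⊤)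
    (hs : 2304 * (ENNReal.ofReal (4 * π) * (Fintype.card (Fin 3) : ℝ≥0∞) ^ 2) ^ 2 *
        ((SNormLESNormFDerivOfEqConst ℂ (volume : Measure (EuclideanSpace ℝ (Fin 3))) 2 *
          ENNReal.ofReal (2 * π)) ^ (3 / 2 : ℝ)) ^ 2 * ENNReal.ofReal c⁻¹ *
        (ENNReal.ofReal T * ENNReal.ofReal (2 / c)) ^ (1 / 2 : ℝ) *
        (∫⁻ η, (ENNReal.ofReal ‖η‖ * ∑ j, ‖a η j‖ₑ) ^ 2) ≤ 1) :
    Continuous (uncurry fun t ξ => heat c ξ (clamp T t) • a ξ - picardLimit c T a t ξ) := by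
  obtain ⟨B, hB⟩ := exists_norm_picardIter_sub_picardLimit_le hc hT ha haw hs 0
  have hunif : TendstoUniformly (fun n => uncurry fun t ξ => heat c ξ (clamp T t) • a ξ - picardIter c T a n t ξ)
      (uncurry fun t ξ => heat c ξ (clamp T t) • a ξ - picardLimit c T a t ξ) atTop := by
    rw [Metric.tendstoUniformly_iff]
    intro ε hε
    obtain ⟨N, hN⟩ : ∃ N : ℕ, |B| * (1 / 2 : ℝ) ^ N < ε := by
      have : Tendsto (fun n : ℕ => |B| * (1 / 2 : ℝ) ^ n) atTop (𝓝 (|B| * 0)) :=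
        (tendsto_pow_atTop_nhds_zero_of_lt_one (by norm_num) (by norm_num)).const_mul _
      rw [mul_zero] at this
      exact (this.eventually (gt_mem_nhds hε)).exists
    refine eventually_atTop.2 ⟨N, fun n hn p => ?_⟩
    have hpow : (1 / 2 : ℝ) ^ n ≤ (1 / 2) ^ N := pow_le_pow_of_le_one (by norm_num) (by norm_num) hn
    have h1 := hB n p.1 p.2
    rw [pow_zero, one_mul] at h1
    rw [dist_eq_norm]
    calc ‖uncurry (fun t ξ => heat c ξ (clamp T t) • a ξ - picardLimit c T a t ξ) p -
          uncurry (fun t ξ => heat c ξ (clamp T t) • a ξ - picardIter c T a n t ξ) p‖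
        = ‖picardIter c T a n p.1 p.2 - picardLimit c T a p.1 p.2‖ := by
          simp only [uncurry]; congr 1; abel
      _ ≤ B * (1 / 2) ^ n := h1
      _ ≤ |B| * (1 / 2) ^ n := mul_le_mul_of_nonneg_right (le_abs_self B) (by positivity)
      _ ≤ |B| * (1 / 2) ^ N := mul_le_mul_of_nonneg_left hpow (abs_nonneg B)
      _ < ε := hN
  exact hunif.continuous (Eventually.of_forall fun n => (class_picardIter hc.le hT ha haw n).1).frequently

/-- **Pointwise polynomial decay of every order of the Duhamel part of the limit, uniformly in
time** (the uniform decay of the `E_n` passes to the limit). [cite: Tao2011, Thm. 5.4 (ii)+(iv)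
(arXiv Thm. 31)] -/
theorem exists_hasDecay_hsub_picardLimit (hc : 0 < c) (hT : 0 ≤ T) (ha : AEStronglyMeasurable a volume)
    (haw : ∀ (k : ℕ) j, ∫⁻ η, (ENNReal.ofReal ((1 + ‖η‖) ^ k) * ‖a η j‖ₑ) ^ 2 < ⊤)
    (hs : 2304 * (ENNReal.ofReal (4 * π) * (Fintype.card (Fin 3) : ℝ≥0∞) ^ 2) ^ 2 *
        ((SNormLESNormFDerivOfEqConst ℂ (volume : Measure (EuclideanSpace ℝ (Fin 3))) 2 *
          ENNReal.ofReal (2 * π)) ^ (3 / 2 : ℝ)) ^ 2 * ENNReal.ofReal c⁻¹ *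
        (ENNReal.ofReal T * ENNReal.ofReal (2 / c)) ^ (1 / 2 : ℝ) *
        (∫⁻ η, (ENNReal.ofReal ‖η‖ * ∑ j, ‖a η j‖ₑ) ^ 2) ≤ 1) (K : ℕ) :
    ∃ B : ℝ, ∀ t, HasDecay K B (fun ξ => heat c ξ (clamp T t) • a ξ - picardLimit c T a t ξ) := by
  obtain ⟨B, hB⟩ := exists_uniform_hasDecay_picardIter hc hT ha haw hs K
  refine ⟨B, fun t ξ => ?_⟩
  have ht : Tendsto (fun n => heat c ξ (clamp T t) • a ξ - picardIter c T a n t ξ) atTop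
      (𝓝 (heat c ξ (clamp T t) • a ξ - picardLimit c T a t ξ)) :=
    tendsto_const_nhds.sub (tendsto_picardIter_picardLimit hc hT ha haw hs t ξ)
  exact le_of_tendsto ((continuous_norm.tendsto _).comp ht) (Eventually.of_forall fun n => hB n t ξ)

/-- **The initial value**: `picardLimit c T a 0 = a` (every iterate equals `a` at `t = 0`).
[folklore] -/
theorem picardLimit_zero (hc : 0 < c) (hT : 0 ≤ T) (ha : AEStronglyMeasurable a volume)
    (haw : ∀ (k : ℕ) j, ∫⁻ η, (ENNReal.ofReal ((1 + ‖η‖) ^ k) * ‖a η j‖ₑ) ^ 2 < ⊤)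
    (hs : 2304 * (ENNReal.ofReal (4 * π) * (Fintype.card (Fin 3) : ℝ≥0∞) ^ 2) ^ 2 *
        ((SNormLESNormFDerivOfEqConst ℂ (volume : Measure (EuclideanSpace ℝ (Fin 3))) 2 *
          ENNReal.ofReal (2 * π)) ^ (3 / 2 : ℝ)) ^ 2 * ENNReal.ofReal c⁻¹ *
        (ENNReal.ofReal T * ENNReal.ofReal (2 / c)) ^ (1 / 2 : ℝ) *
        (∫⁻ η, (ENNReal.ofReal ‖η‖ * ∑ j, ‖a η j‖ₑ) ^ 2) ≤ 1) (ξ : EuclideanSpace ℝ (Fin 3)) :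
    picardLimit c T a 0 ξ = a ξ := by
  have hconst : ∀ n, picardIter c T a n 0 ξ = a ξ := fun n => by
    cases n with
    | zero => simp [picardIter, clamp_zero hT]
    | succ n => exact duhamel_zero hT ξ
  have h := tendsto_picardIter_picardLimit hc hT ha haw hs 0 ξ
  simp_rw [hconst] at h
  exact (tendsto_nhds_unique tendsto_const_nhds h).symm

/-- **Divergence-free limit**: `∑ₗ ξₗ picardLimit(t,ξ)ₗ = 0` if the datum is divergence free
(induction along the iteration in the `L²` class, then the pointwise limit). [folklore] -/
theorem sum_mul_picardLimit (hc : 0 < c) (hT : 0 ≤ T) (ha : AEStronglyMeasurable a volume)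
    (haw : ∀ (k : ℕ) j, ∫⁻ η, (ENNReal.ofReal ((1 + ‖η‖) ^ k) * ‖a η j‖ₑ) ^ 2 < ⊤)
    (hs : 2304 * (ENNReal.ofReal (4 * π) * (Fintype.card (Fin 3) : ℝ≥0∞) ^ 2) ^ 2 *
        ((SNormLESNormFDerivOfEqConst ℂ (volume : Measure (EuclideanSpace ℝ (Fin 3))) 2 *
          ENNReal.ofReal (2 * π)) ^ (3 / 2 : ℝ)) ^ 2 * ENNReal.ofReal c⁻¹ *
        (ENNReal.ofReal T * ENNReal.ofReal (2 / c)) ^ (1 / 2 : ℝ) *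
        (∫⁻ η, (ENNReal.ofReal ‖η‖ * ∑ j, ‖a η j‖ₑ) ^ 2) ≤ 1)
    (hdiv : ∀ ξ, ∑ l, ((ξ l : ℝ) : ℂ) * a ξ l = 0) (t : ℝ) (ξ : EuclideanSpace ℝ (Fin 3)) :
    ∑ l, ((ξ l : ℝ) : ℂ) * picardLimit c T a t ξ l = 0 := by
  have hiter : ∀ n, ∑ l, ((ξ l : ℝ) : ℂ) * picardIter c T a n t ξ l = 0 := by
    intro n
    induction n with
    | zero =>
      simp only [picardIter, Pi.smul_apply, Complex.real_smul]
      calc ∑ l, ((ξ l : ℝ) : ℂ) * ((heat c ξ (clamp T t) : ℂ) * a ξ l)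
          = (heat c ξ (clamp T t) : ℂ) * ∑ l, ((ξ l : ℝ) : ℂ) * a ξ l := by
            rw [Finset.mul_sum]; congr 1 with l; ring
        _ = 0 := by rw [hdiv, mul_zero]
    | succ n _ =>
      -- the `L²` package of `v_n = h - E_n`
      set En : ℝ → EuclideanSpace ℝ (Fin 3) → Fin 3 → ℂ :=
        fun t ξ => heat c ξ (clamp T t) • a ξ - picardIter c T a n t ξ with hEn
      obtain ⟨hEc, hEd⟩ := class_picardIter hc.le hT ha haw n
      have hm₀lt : Module.finrank ℝ (EuclideanSpace ℝ (Fin 3)) <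
          2 * (Module.finrank ℝ (EuclideanSpace ℝ (Fin 3)) + 1) := finrank_lt_two_mul_succ
      have ha2 : ∀ j, ∫⁻ η, ‖a η j‖ₑ ^ 2 < ⊤ := fun j => by simpa using haw 0 j
      obtain ⟨B₀, hB₀⟩ := hEd (Module.finrank ℝ (EuclideanSpace ℝ (Fin 3)) + 1)
      have hv2 : ∀ s j, MemLp (fun η => picardIter c T a n s η j) 2 volume := fun s j => by
        have h := memLp_hsub_apply c T a En hc.le ha ha2 hEc hm₀lt hB₀ s j
        simpa only [hEn, sub_sub_cancel] using h
      have hvc : ∀ j s₀, Tendsto (fun s => eLpNorm ((fun η => picardIter c T a n s η j) -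
          (fun η => picardIter c T a n s₀ η j)) 2 volume) (𝓝 s₀) (𝓝 0) := fun j s₀ => by
        have h := tendsto_eLpNorm_hsub_apply c T a En hc.le ha ha2 hEc hm₀lt hB₀ j s₀
        simpa only [hEn, sub_sub_cancel] using h
      show ∑ l, ((ξ l : ℝ) : ℂ) * duhamel c T a (picardIter c T a n) t ξ l = 0
      exact sum_mul_duhamel_of_tendsto hv2 hvc hdiv t ξ
  have h := tendsto_picardIter_picardLimit hc hT ha haw hs t ξ
  have hcont : Continuous fun z : Fin 3 → ℂ => ∑ l, ((ξ l : ℝ) : ℂ) * z l := by fun_prop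
  have h2 := (hcont.tendsto _).comp h
  simp only [Function.comp_def, hiter] at h2
  exact (tendsto_nhds_unique tendsto_const_nhds h2).symm

/-- **Conjugation symmetry of the limit**: `picardLimit(t,-ξ)ₗ = conj picardLimit(t,ξ)ₗ` if
`a(-ξ) = conj a(ξ)` (induction along the iteration, then the limit). [folklore] -/
theorem picardLimit_conj_symm (hc : 0 < c) (hT : 0 ≤ T) (ha : AEStronglyMeasurable a volume)
    (haw : ∀ (k : ℕ) j, ∫⁻ η, (ENNReal.ofReal ((1 + ‖η‖) ^ k) * ‖a η j‖ₑ) ^ 2 < ⊤)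
    (hs : 2304 * (ENNReal.ofReal (4 * π) * (Fintype.card (Fin 3) : ℝ≥0∞) ^ 2) ^ 2 *
        ((SNormLESNormFDerivOfEqConst ℂ (volume : Measure (EuclideanSpace ℝ (Fin 3))) 2 *
          ENNReal.ofReal (2 * π)) ^ (3 / 2 : ℝ)) ^ 2 * ENNReal.ofReal c⁻¹ *
        (ENNReal.ofReal T * ENNReal.ofReal (2 / c)) ^ (1 / 2 : ℝ) *
        (∫⁻ η, (ENNReal.ofReal ‖η‖ * ∑ j, ‖a η j‖ₑ) ^ 2) ≤ 1)
    (haconj : ∀ ξ l, a (-ξ) l = conj (a ξ l)) (t : ℝ) (ξ : EuclideanSpace ℝ (Fin 3)) (l : Fin 3) :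
    picardLimit c T a t (-ξ) l = conj (picardLimit c T a t ξ l) := by
  have hiter : ∀ n s ζ j, picardIter c T a n s (-ζ) j = conj (picardIter c T a n s ζ j) := by
    intro n
    induction n with
    | zero =>
      intro s ζ j
      simp [picardIter, heat_neg, haconj, Complex.conj_ofReal]
    | succ n ih =>
      intro s ζ j
      set En : ℝ → EuclideanSpace ℝ (Fin 3) → Fin 3 → ℂ :=
        fun t ξ => heat c ξ (clamp T t) • a ξ - picardIter c T a n t ξ with hEn
      obtain ⟨hEc, hEd⟩ := class_picardIter hc.le hT ha haw n
      have hm₀lt : Module.finrank ℝ (EuclideanSpace ℝ (Fin 3)) <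
          2 * (Module.finrank ℝ (EuclideanSpace ℝ (Fin 3)) + 1) := finrank_lt_two_mul_succ
      have ha2 : ∀ j, ∫⁻ η, ‖a η j‖ₑ ^ 2 < ⊤ := fun j => by simpa using haw 0 j
      obtain ⟨B₀, hB₀⟩ := hEd (Module.finrank ℝ (EuclideanSpace ℝ (Fin 3)) + 1)
      have hv2 : ∀ s j, MemLp (fun η => picardIter c T a n s η j) 2 volume := fun s j => by
        have h := memLp_hsub_apply c T a En hc.le ha ha2 hEc hm₀lt hB₀ s j
        simpa only [hEn, sub_sub_cancel] using h
      have hvc : ∀ j s₀, Tendsto (fun s => eLpNorm ((fun η => picardIter c T a n s η j) -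
          (fun η => picardIter c T a n s₀ η j)) 2 volume) (𝓝 s₀) (𝓝 0) := fun j s₀ => by
        have h := tendsto_eLpNorm_hsub_apply c T a En hc.le ha ha2 hEc hm₀lt hB₀ j s₀
        simpa only [hEn, sub_sub_cancel] using h
      show duhamel c T a (picardIter c T a n) s (-ζ) j = conj (duhamel c T a (picardIter c T a n) s ζ j)
      exact duhamel_conj_symm_of_tendsto hv2 hvc haconj ih s ζ j
  have h := tendsto_picardIter_picardLimit hc hT ha haw hs t ξ
  have h' := tendsto_picardIter_picardLimit hc hT ha haw hs t (-ξ)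
  have h1 : Tendsto (fun n => picardIter c T a n t (-ξ) l) atTop (𝓝 (picardLimit c T a t (-ξ) l)) :=
    ((continuous_apply l).tendsto _).comp h'
  have h2 : Tendsto (fun n => conj (picardIter c T a n t ξ l)) atTop (𝓝 (conj (picardLimit c T a t ξ l))) :=
    (Complex.continuous_conj.tendsto _).comp (((continuous_apply l).tendsto _).comp h)
  simp only [hiter] at h1
  exact tendsto_nhds_unique h1 h2


/-- Measurability of the time slices of the limit. [folklore] -/
theorem aestronglyMeasurable_picardLimit (hc : 0 < c) (hT : 0 ≤ T) (ha : AEStronglyMeasurable a volume)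
    (haw : ∀ (k : ℕ) j, ∫⁻ η, (ENNReal.ofReal ((1 + ‖η‖) ^ k) * ‖a η j‖ₑ) ^ 2 < ⊤)
    (hs : 2304 * (ENNReal.ofReal (4 * π) * (Fintype.card (Fin 3) : ℝ≥0∞) ^ 2) ^ 2 *
        ((SNormLESNormFDerivOfEqConst ℂ (volume : Measure (EuclideanSpace ℝ (Fin 3))) 2 *
          ENNReal.ofReal (2 * π)) ^ (3 / 2 : ℝ)) ^ 2 * ENNReal.ofReal c⁻¹ *
        (ENNReal.ofReal T * ENNReal.ofReal (2 / c)) ^ (1 / 2 : ℝ) *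
        (∫⁻ η, (ENNReal.ofReal ‖η‖ * ∑ j, ‖a η j‖ₑ) ^ 2) ≤ 1) (t : ℝ) :
    AEStronglyMeasurable (picardLimit c T a t) volume := by
  have hEc := continuous_hsub_picardLimit hc hT ha haw hs
  have h : picardLimit c T a t = fun ξ => heat c ξ (clamp T t) • a ξ -
      (heat c ξ (clamp T t) • a ξ - picardLimit c T a t ξ) := by
    funext ξ; rw [sub_sub_cancel]
  rw [h]
  exact aestronglyMeasurable_hsub_slice c T a _ ha hEc t

/-- **The limit solves the mild (Duhamel) equation**: `picardLimit = duhamel c T a picardLimit`,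
i.e. `v(t) = heat(t) • a - ∫₀ᵗ heat(t-s) • N(v(s), v(s)) ds` at every frequency (pass to the
limit in `v_{n+1} = Φ(v_n)`: the Duhamel integrals converge by the weighted difference step
`exp_weight_enorm_duhamelIntegral_hsub_sub_le` applied to `E_n` and `E = h - v`, whose difference
decays like `2^{-n}(1+‖η‖)^{-2}`). [cite: Tao2011, Thm. 5.4 (ii) (arXiv Thm. 31); proof of Thm. 5.1
(arXiv p. 16)] -/
theorem picardLimit_eq_duhamel (hc : 0 < c) (hT : 0 ≤ T) (ha : AEStronglyMeasurable a volume)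
    (haw : ∀ (k : ℕ) j, ∫⁻ η, (ENNReal.ofReal ((1 + ‖η‖) ^ k) * ‖a η j‖ₑ) ^ 2 < ⊤)
    (hs : 2304 * (ENNReal.ofReal (4 * π) * (Fintype.card (Fin 3) : ℝ≥0∞) ^ 2) ^ 2 *
        ((SNormLESNormFDerivOfEqConst ℂ (volume : Measure (EuclideanSpace ℝ (Fin 3))) 2 *
          ENNReal.ofReal (2 * π)) ^ (3 / 2 : ℝ)) ^ 2 * ENNReal.ofReal c⁻¹ *
        (ENNReal.ofReal T * ENNReal.ofReal (2 / c)) ^ (1 / 2 : ℝ) *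
        (∫⁻ η, (ENNReal.ofReal ‖η‖ * ∑ j, ‖a η j‖ₑ) ^ 2) ≤ 1) (t : ℝ) (ξ : EuclideanSpace ℝ (Fin 3)) :
    picardLimit c T a t ξ = duhamel c T a (picardLimit c T a) t ξ := by
  -- reduce to `t ∈ [0, T]`
  suffices hIcc : ∀ t ∈ Icc 0 T, ∀ ξ, picardLimit c T a t ξ = duhamel c T a (picardLimit c T a) t ξ by
    have h := hIcc (clamp T t) (clamp_mem_Icc hT t) ξ
    rwa [picardLimit_clamp hT t, duhamel_clamp hT t ξ] at h
  intro t ht ξ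
  -- the Duhamel part of the limit and its class
  set E : ℝ → EuclideanSpace ℝ (Fin 3) → Fin 3 → ℂ :=
    fun t ξ => heat c ξ (clamp T t) • a ξ - picardLimit c T a t ξ with hE
  have hEc : Continuous (uncurry E) := continuous_hsub_picardLimit hc hT ha haw hs
  have hEd : ∀ K : ℕ, ∃ B : ℝ, ∀ t, HasDecay K B (E t) := fun K =>
    exists_hasDecay_hsub_picardLimit hc hT ha haw hs K
  have hv : (fun s η => heat c η (clamp T s) • a η - E s η) = picardLimit c T a := by
    funext s η; simp [hE]
  -- the two limits of `v_{n+1}(t, ξ)`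
  have hlim := tendsto_picardIter_picardLimit hc hT ha haw hs t ξ
  have hlim1 : Tendsto (fun n => picardIter c T a (n + 1) t ξ) atTop (𝓝 (picardLimit c T a t ξ)) :=
    hlim.comp (tendsto_add_atTop_nat 1)
  suffices hD : Tendsto (fun n => duhamelIntegral c T (picardIter c T a n) t ξ) atTop
      (𝓝 (duhamelIntegral c T (picardLimit c T a) t ξ)) by
    have h2 : Tendsto (fun n => picardIter c T a (n + 1) t ξ) atTop
        (𝓝 (heat c ξ (clamp T t) • a ξ - duhamelIntegral c T (picardLimit c T a) t ξ)) := by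
      have h3 : Tendsto (fun n => heat c ξ (clamp T t) • a ξ - duhamelIntegral c T (picardIter c T a n) t ξ)
          atTop (𝓝 (heat c ξ (clamp T t) • a ξ - duhamelIntegral c T (picardLimit c T a) t ξ)) :=
        tendsto_const_nhds.sub hD
      refine h3.congr fun n => ?_
      rw [picardIter, duhamel_eq]
    rw [duhamel_eq]
    exact tendsto_nhds_unique hlim1 h2
  -- uniform inputs: decay of orders 2 and 4 of the `E_n` and of `E`, and the rate of order 2
  obtain ⟨B₂, hB₂⟩ := exists_uniform_hasDecay_picardIter hc hT ha haw hs 2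
  obtain ⟨B₄, hB₄⟩ := exists_uniform_hasDecay_picardIter hc hT ha haw hs 4
  obtain ⟨B₂', hB₂'⟩ := hEd 2
  obtain ⟨B₄', hB₄'⟩ := hEd 4
  obtain ⟨Br, hBr⟩ := exists_norm_picardIter_sub_picardLimit_le hc hT ha haw hs 2
  have hBr0 : 0 ≤ Br := by
    have h := hBr 0 t ξ
    rw [pow_zero, mul_one] at h
    exact le_trans (by positivity) h
  -- the envelopes
  set Amaj : EuclideanSpace ℝ (Fin 3) → ℝ≥0∞ := fun η => ∑ j, ‖a η j‖ₑ with hAmaj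
  have hAm : AEMeasurable Amaj volume := aemeasurable_majorant ha
  set w2inv : EuclideanSpace ℝ (Fin 3) → ℝ≥0∞ := fun η => (ENNReal.ofReal ((1 + ‖η‖) ^ 2))⁻¹ with hw2inv
  set w4inv : EuclideanSpace ℝ (Fin 3) → ℝ≥0∞ := fun η => (ENNReal.ofReal ((1 + ‖η‖) ^ 4))⁻¹ with hw4inv
  have hw2m : Measurable w2inv := (measurable_ofReal_weight 2).inv
  have hw4m : Measurable w4inv := (measurable_ofReal_weight 4).inv
  set Ψ : EuclideanSpace ℝ (Fin 3) → ℝ≥0∞ := fun η => ENNReal.ofReal B₄ * w4inv η with hΨ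
  set Ψ' : EuclideanSpace ℝ (Fin 3) → ℝ≥0∞ := fun η => ENNReal.ofReal B₄' * w4inv η with hΨ'
  set b : ℝ≥0∞ := ENNReal.ofReal B₂ + ENNReal.ofReal B₂' with hb
  set Qn : ℕ → EuclideanSpace ℝ (Fin 3) → ℝ≥0∞ := fun n η => ENNReal.ofReal (Br * (1 / 2) ^ n) * w2inv η
    with hQn
  have hwdec : ∀ {F : EuclideanSpace ℝ (Fin 3) → Fin 3 → ℂ} {K : ℕ} {B : ℝ}, HasDecay K B F →
      ∀ η, ENNReal.ofReal ((1 + ‖η‖) ^ K) * ‖F η‖ₑ ≤ ENNReal.ofReal B := by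
    intro F K B hF η
    have hw0 : ENNReal.ofReal ((1 + ‖η‖) ^ K) ≠ 0 :=
      (lt_of_lt_of_le zero_lt_one (one_le_ofReal_weight K η)).ne'
    calc ENNReal.ofReal ((1 + ‖η‖) ^ K) * ‖F η‖ₑ
        ≤ ENNReal.ofReal ((1 + ‖η‖) ^ K) * (ENNReal.ofReal B * (ENNReal.ofReal ((1 + ‖η‖) ^ K))⁻¹) :=
          mul_le_mul' le_rfl (hF.enorm_le η)
      _ = ENNReal.ofReal B := by
          rw [mul_comm (ENNReal.ofReal B), ← mul_assoc, ENNReal.mul_inv_cancel hw0 ENNReal.ofReal_ne_top,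
            one_mul]
  -- the bound of the Duhamel differences
  set C : ℝ≥0∞ := ENNReal.ofReal (4 * π) * (Fintype.card (Fin 3) : ℝ≥0∞) ^ 2 with hC
  set μ : ℝ≥0∞ := ENNReal.ofReal (1 / (2 * Real.sqrt (c * 1))) * (C * 2 ^ 0) with hμ
  set G₀ : EuclideanSpace ℝ (Fin 3) → ℝ≥0∞ := fun η => Amaj η + 3 * Ψ η with hG₀
  set G₀' : EuclideanSpace ℝ (Fin 3) → ℝ≥0∞ := fun η => Amaj η + 3 * Ψ' η with hG₀'
  set GK : EuclideanSpace ℝ (Fin 3) → ℝ≥0∞ := fun η => ENNReal.ofReal ((1 + ‖η‖) ^ 0) * Amaj η +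
    3 * (b * (ENNReal.ofReal ((1 + ‖η‖) ^ 2))⁻¹) with hGK
  have hG₀m : AEMeasurable G₀ volume := hAm.add ((hw4m.const_mul _).const_mul _).aemeasurable
  have hG₀'m : AEMeasurable G₀' volume := hAm.add ((hw4m.const_mul _).const_mul _).aemeasurable
  have hGKm : AEMeasurable GK volume :=
    ((measurable_ofReal_weight 0).aemeasurable.mul hAm).add
      (((measurable_ofReal_weight 2).inv.const_mul _).const_mul _).aemeasurable
  set Mb : ℝ≥0∞ := μ * (3 * (2 * (∫⁻ η, GK η ^ 2) ^ (1 / 2 : ℝ) + (∫⁻ η, G₀ η ^ 2) ^ (1 / 2 : ℝ) +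
    (∫⁻ η, G₀' η ^ 2) ^ (1 / 2 : ℝ))) with hMb
  -- finiteness of `Mb`
  have hW2 : ∫⁻ η, w2inv η ^ 2 < ⊤ := lintegral_weight_inv_sq_lt_top finrank_three_lt_four
  have hW4 : ∫⁻ η, w4inv η ^ 2 < ⊤ := by
    refine lt_of_le_of_lt (lintegral_mono fun η => pow_le_pow_left' ?_ 2) hW2
    exact ENNReal.inv_le_inv.2 (ENNReal.ofReal_le_ofReal
      (pow_le_pow_right₀ (by linarith [norm_nonneg η]) (by norm_num)))
  have hsq : ∀ x y : ℝ≥0∞, (x + y) ^ 2 ≤ 2 * x ^ 2 + 2 * y ^ 2 := fun x y => by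
    have h := ENNReal.rpow_add_le_mul_rpow_add_rpow x y (p := 2) (by norm_num)
    norm_num at h
    rw [← mul_add]
    exact_mod_cast h
  have hα0 : ∫⁻ η, Amaj η ^ 2 < ⊤ := by
    have h := lintegral_weight_majorant_sq_lt_top ha 0 (haw 0)
    simpa using h
  have hL2 : ∀ {F G : EuclideanSpace ℝ (Fin 3) → ℝ≥0∞}, AEMeasurable F volume →
      ∫⁻ η, F η ^ 2 < ⊤ → ∫⁻ η, G η ^ 2 < ⊤ → ∫⁻ η, (F η + G η) ^ 2 < ⊤ := by
    intro F G hFm hF hG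
    refine lt_of_le_of_lt (lintegral_mono fun η => hsq _ _) ?_
    rw [lintegral_add_left' ((hFm.pow_const 2).const_mul _), lintegral_const_mul' _ _ (by norm_num),
      lintegral_const_mul' _ _ (by norm_num)]
    exact ENNReal.add_lt_top.2 ⟨ENNReal.mul_lt_top (by norm_num) hF, ENNReal.mul_lt_top (by norm_num) hG⟩
  have hcw : ∀ (x : ℝ≥0∞) {W : EuclideanSpace ℝ (Fin 3) → ℝ≥0∞}, x ≠ ⊤ → Measurable W →
      ∫⁻ η, W η ^ 2 < ⊤ → ∫⁻ η, (x * W η) ^ 2 < ⊤ := by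
    intro x W hx hWm hW
    simp_rw [mul_pow]
    rw [lintegral_const_mul' _ _ (ENNReal.pow_ne_top hx)]
    exact ENNReal.mul_lt_top (ENNReal.pow_lt_top hx.lt_top) hW
  have hG₀2 : ∫⁻ η, G₀ η ^ 2 < ⊤ := hL2 hAm hα0 (by
    have h := hcw (3 * ENNReal.ofReal B₄) (ENNReal.mul_ne_top (by norm_num) ENNReal.ofReal_ne_top) hw4m hW4
    refine lt_of_le_of_lt (le_of_eq (lintegral_congr fun η => ?_)) h
    simp only [hΨ]; ring)
  have hG₀'2 : ∫⁻ η, G₀' η ^ 2 < ⊤ := hL2 hAm hα0 (by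
    have h := hcw (3 * ENNReal.ofReal B₄') (ENNReal.mul_ne_top (by norm_num) ENNReal.ofReal_ne_top) hw4m hW4
    refine lt_of_le_of_lt (le_of_eq (lintegral_congr fun η => ?_)) h
    simp only [hΨ']; ring)
  have hbtop : b ≠ ⊤ := ENNReal.add_ne_top.2 ⟨ENNReal.ofReal_ne_top, ENNReal.ofReal_ne_top⟩
  have hGK2 : ∫⁻ η, GK η ^ 2 < ⊤ := by
    refine hL2 ((measurable_ofReal_weight 0).aemeasurable.mul hAm) ?_ ?_
    · refine lt_of_le_of_lt (le_of_eq (lintegral_congr fun η => ?_)) hα0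
      simp
    · have h := hcw (3 * b) (ENNReal.mul_ne_top (by norm_num) hbtop) hw2m hW2
      refine lt_of_le_of_lt (le_of_eq (lintegral_congr fun η => ?_)) h
      simp only [hw2inv]; ring
  have hμtop : μ < ⊤ := ENNReal.mul_lt_top ENNReal.ofReal_lt_top
    (ENNReal.mul_lt_top (ENNReal.mul_lt_top ENNReal.ofReal_lt_top (by simp)) (by simp))
  have hrt : ∀ {x : ℝ≥0∞}, x < ⊤ → x ^ (1 / 2 : ℝ) < ⊤ := fun h =>
    ENNReal.rpow_lt_top_of_nonneg (by norm_num) h.ne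
  have hMbtop : Mb < ⊤ := ENNReal.mul_lt_top hμtop (ENNReal.mul_lt_top (by norm_num)
    (ENNReal.add_lt_top.2 ⟨ENNReal.add_lt_top.2 ⟨ENNReal.mul_lt_top (by norm_num) (hrt hGK2), hrt hG₀2⟩,
      hrt hG₀'2⟩))
  -- the `L²` norm of `Q_n`
  have hQn2 : ∀ n, (∫⁻ η, Qn n η ^ 2) ^ (1 / 2 : ℝ) =
      ENNReal.ofReal (Br * (1 / 2) ^ n) * (∫⁻ η, w2inv η ^ 2) ^ (1 / 2 : ℝ) := by
    intro n
    simp only [hQn]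
    simp_rw [mul_pow]
    rw [lintegral_const_mul' _ _ (ENNReal.pow_ne_top ENNReal.ofReal_ne_top),
      ENNReal.mul_rpow_of_nonneg _ _ (by norm_num), ← ENNReal.rpow_natCast, ← ENNReal.rpow_mul]
    norm_num
  -- the key estimate for every `n`
  have hkey : ∀ n, ‖duhamelIntegral c T (picardIter c T a n) t ξ -
      duhamelIntegral c T (picardLimit c T a) t ξ‖ₑ ≤
      ENNReal.ofReal (Real.exp t) * (Mb * (ENNReal.ofReal (Br * (1 / 2) ^ n) *
        (∫⁻ η, w2inv η ^ 2) ^ (1 / 2 : ℝ))) := by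
    intro n
    set En : ℝ → EuclideanSpace ℝ (Fin 3) → Fin 3 → ℂ :=
      fun t ξ => heat c ξ (clamp T t) • a ξ - picardIter c T a n t ξ with hEn
    have hvn : (fun s η => heat c η (clamp T s) • a η - En s η) = picardIter c T a n := by
      funext s η; simp [hEn]
    obtain ⟨hEnc, hEnd⟩ := class_picardIter hc.le hT ha haw n
    have hΨ₁ : ∀ s ∈ Icc 0 T, ∀ η, ‖En s η‖ₑ ≤ Ψ η := by
      intro s _ η
      have h := (hB₄ n s).enorm_le η
      exact h
    have hΨ₂ : ∀ s ∈ Icc 0 T, ∀ η, ‖E s η‖ₑ ≤ Ψ' η := by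
      intro s _ η
      exact (hB₄' s).enorm_le η
    have hb₁ : ∀ s ∈ Icc 0 T, ∀ η, ENNReal.ofReal ((1 + ‖η‖) ^ (0 + 2)) * ‖En s η‖ₑ ≤ b :=
      fun s _ η => (hwdec (hB₂ n s) η).trans le_self_add
    have hb₂ : ∀ s ∈ Icc 0 T, ∀ η, ENNReal.ofReal ((1 + ‖η‖) ^ (0 + 2)) * ‖E s η‖ₑ ≤ b :=
      fun s _ η => (hwdec (hB₂' s) η).trans le_add_self
    have hQ : ∀ s ∈ Icc 0 T, ∀ η, ENNReal.ofReal (Real.exp (-1 * s) * (1 + ‖η‖) ^ 0) *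
        ‖En s η - E s η‖ₑ ≤ Qn n η := by
      intro s hs η
      have hdiff : En s η - E s η = picardLimit c T a s η - picardIter c T a n s η := by
        simp only [hEn, hE, sub_sub_sub_cancel_left]
      have hrate : ENNReal.ofReal ((1 + ‖η‖) ^ 2) * ‖picardLimit c T a s η - picardIter c T a n s η‖ₑ ≤
          ENNReal.ofReal (Br * (1 / 2) ^ n) := by
        rw [enorm_sub_rev, ← ofReal_norm, ← ENNReal.ofReal_mul (by positivity)]
        exact ENNReal.ofReal_le_ofReal (hBr n s η)
      have he : ENNReal.ofReal (Real.exp (-1 * s) * (1 + ‖η‖) ^ 0) ≤ 1 := by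
        rw [pow_zero, mul_one, ← ENNReal.ofReal_one]
        exact ENNReal.ofReal_le_ofReal (Real.exp_le_one_iff.2 (by nlinarith [hs.1]))
      have hw0 : ENNReal.ofReal ((1 + ‖η‖) ^ 2) ≠ 0 :=
        (lt_of_lt_of_le zero_lt_one (one_le_ofReal_weight 2 η)).ne'
      rw [hdiff]
      calc ENNReal.ofReal (Real.exp (-1 * s) * (1 + ‖η‖) ^ 0) * ‖picardLimit c T a s η - picardIter c T a n s η‖ₑ
          ≤ 1 * ‖picardLimit c T a s η - picardIter c T a n s η‖ₑ := mul_le_mul' he le_rfl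
        _ = w2inv η * (ENNReal.ofReal ((1 + ‖η‖) ^ 2) * ‖picardLimit c T a s η - picardIter c T a n s η‖ₑ) := by
            rw [one_mul, ← mul_assoc, hw2inv, ENNReal.inv_mul_cancel hw0 ENNReal.ofReal_ne_top, one_mul]
        _ ≤ w2inv η * ENNReal.ofReal (Br * (1 / 2) ^ n) := mul_le_mul' le_rfl hrate
        _ = Qn n η := by rw [hQn, mul_comm]
    have hmain := exp_weight_enorm_duhamelIntegral_hsub_sub_le (T := T) hc ha haw hEnc hEnd hEc hEd 0
      one_pos hΨ₁ hΨ₂ hb₁ hb₂ hQ ht ξ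
    rw [hvn, hv] at hmain
    have hQm : AEMeasurable (Qn n) volume := (hw2m.const_mul _).aemeasurable
    have hbound : ENNReal.ofReal (Real.exp (-1 * t) * (1 + ‖ξ‖) ^ 0) *
        ‖duhamelIntegral c T (picardIter c T a n) t ξ - duhamelIntegral c T (picardLimit c T a) t ξ‖ₑ ≤
        Mb * (∫⁻ η, Qn n η ^ 2) ^ (1 / 2 : ℝ) :=
      calc _ ≤ _ := hmain
        _ = μ * (3 * (((fun η => (ENNReal.ofReal ((1 + ‖η‖) ^ 0))⁻¹ * Qn n η) ⋆ₗ GK) ξ + (Qn n ⋆ₗ G₀) ξ +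
            (G₀' ⋆ₗ Qn n) ξ + (GK ⋆ₗ (fun η => (ENNReal.ofReal ((1 + ‖η‖) ^ 0))⁻¹ * Qn n η)) ξ)) := by
            simp only [hμ, hC, hGK, hG₀, hG₀', hAmaj]
            ring
        _ ≤ _ := diff_majorant_le hQm hG₀m hG₀'m hGKm 0 μ ξ
        _ = Mb * (∫⁻ η, Qn n η ^ 2) ^ (1 / 2 : ℝ) := by rw [hMb]; ring
    rw [hQn2 n] at hbound
    -- remove the exponential weight
    have hexp : (1 : ℝ≥0∞) = ENNReal.ofReal (Real.exp t) * ENNReal.ofReal (Real.exp (-1 * t) * (1 + ‖ξ‖) ^ 0) := by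
      rw [pow_zero, mul_one, ← ENNReal.ofReal_mul (Real.exp_pos _).le, ← Real.exp_add,
        show t + -1 * t = 0 by ring, Real.exp_zero, ENNReal.ofReal_one]
    calc ‖duhamelIntegral c T (picardIter c T a n) t ξ - duhamelIntegral c T (picardLimit c T a) t ξ‖ₑ
        = ENNReal.ofReal (Real.exp t) * (ENNReal.ofReal (Real.exp (-1 * t) * (1 + ‖ξ‖) ^ 0) *
            ‖duhamelIntegral c T (picardIter c T a n) t ξ - duhamelIntegral c T (picardLimit c T a) t ξ‖ₑ) := by
          rw [← mul_assoc, ← hexp, one_mul]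
      _ ≤ ENNReal.ofReal (Real.exp t) * (Mb * (ENNReal.ofReal (Br * (1 / 2) ^ n) *
          (∫⁻ η, w2inv η ^ 2) ^ (1 / 2 : ℝ))) := mul_le_mul' le_rfl hbound
  -- the right-hand side tends to zero
  have hzero : Tendsto (fun n : ℕ => ENNReal.ofReal (Real.exp t) * (Mb * (ENNReal.ofReal (Br * (1 / 2) ^ n) *
      (∫⁻ η, w2inv η ^ 2) ^ (1 / 2 : ℝ)))) atTop (𝓝 0) := by
    have h1 : Tendsto (fun n : ℕ => ENNReal.ofReal (Br * (1 / 2) ^ n)) atTop (𝓝 0) := by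
      have h : Tendsto (fun n : ℕ => Br * (1 / 2 : ℝ) ^ n) atTop (𝓝 (Br * 0)) :=
        (tendsto_pow_atTop_nhds_zero_of_lt_one (by norm_num) (by norm_num)).const_mul _
      rw [mul_zero] at h
      have h2 := (ENNReal.continuous_ofReal.tendsto 0).comp h
      rwa [Function.comp_def, ENNReal.ofReal_zero] at h2
    have h2 : Tendsto (fun n : ℕ => ENNReal.ofReal (Br * (1 / 2) ^ n) * (∫⁻ η, w2inv η ^ 2) ^ (1 / 2 : ℝ))
        atTop (𝓝 0) := by
      have h := ENNReal.Tendsto.mul_const h1 (Or.inr (hrt hW2).ne)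
      rwa [zero_mul] at h
    have h3 : Tendsto (fun n : ℕ => Mb * (ENNReal.ofReal (Br * (1 / 2) ^ n) * (∫⁻ η, w2inv η ^ 2) ^ (1 / 2 : ℝ)))
        atTop (𝓝 0) := by
      have h := ENNReal.Tendsto.const_mul h2 (Or.inr hMbtop.ne)
      rwa [mul_zero] at h
    have h4 := ENNReal.Tendsto.const_mul h3 (Or.inr (ENNReal.ofReal_ne_top (r := Real.exp t)))
    rwa [mul_zero] at h4
  rw [tendsto_iff_edist_tendsto_0]
  refine tendsto_of_tendsto_of_tendsto_of_le_of_le tendsto_const_nhds hzero (fun n => zero_le) fun n => ?_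
  rw [edist_eq_enorm_sub]
  exact hkey n

end Limit

end Literature.Analysis.FluidPDE.FourierNS

end
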